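import Literature.Analysis.FluidPDE.HardSphereCollisionIntensity
import HarnessLib

/-!
# The sharp form of the finite collision intensity of the hard-sphere flow on the torus

`HardSphereCollisionIntensity` bounds the expected number of collisions of the hard-sphere flow on
`(T^d × ℝ^d)^N` (`0 < ε < 1/2`) in `(0, t]` on an energy shell `E ≤ V²/2` by `C(N, d, V) · t` with
the crude constant `C(N, d, V) = N² (2 d V vol B₁) vol(B̄_V)^N`, obtained from the volume of the
thin shells `closePair` of `r`-close pairs (`volume_closePair_inter_le`). This file runs the same
window / truncation bookkeeping of Gallagher–Saint-Raymond–Texier 2013 (proof of Prop. 4.1.1) with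
an **arbitrary one-window volume bound for the hit pieces** in place of that crude step: if for
every small window `δ > 0` the hit pieces `Alexander.hitPiece N ε (2Vδ) δ i j` (`i < j`) of the
energy shell have total volume at most `δ · F`, then

`∫⁻_{E ≤ V²/2} #(collisionTimes ∩ (0, t]) d(liouville) ≤ t · F`

(`lintegral_ncard_collisionTimes_le_of_hitPiece_volume`). With `F` the total outgoing contact flux
of the shell (the exact volume of the pre-collisional cylinder of a hit piece) this is the UPPER
bound half of the stationary collision-rate identity (special-flow representation over the
collision boundary, Cercignani–Illner–Pulvirenti 1994 §4.2 and App. 4.A: Lebesgue measure becomes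
`dσ dt`, so the mean number of boundary crossings in `(0, t]` is `t · σ(Σ)`), i.e. the input of
the discharge of `HardSphereCampbellFormula`; here `F : ℝ≥0∞` is an arbitrary constant.

The proof: with mesh `δ = t/(m+1)`, on the survivors `Alexander.iterGood N ε δ V m` the count up
to `t` is at most the number of window-starts `wδ`, `w ≤ m`, at which the orbit lies in the union
`H` of the hit pieces (`Alexander.collisionCount_le_sum_indicator_of_mem_iterGood`); the orbit of
a survivor stays on the shell (`Alexander.configEnergy_fwdFlow`) and the window-start maps do not
lose volume on the survivors (`Alexander.volume_iterGood_inter_preimage_windowStart_le`), so each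
window costs at most `vol(H ∩ shell) ≤ Σ_{i<j} vol(hitPiece ∩ shell) ≤ δ F`, `(m+1) δ F = t F` in
all; the non-survivors cost `K (m+1) · windowLoss → 0` for the truncated count `min(#, K)`
(`Alexander.volume_shell_diff_iterGood_le`, `Alexander.tendsto_windowLoss`), and monotone
convergence in `K` removes the truncation
(`campbell_lintegral_min_collisionCount_shell_le_of_mesh`, `campbell_lintegral_min_collisionCount_shell_le`,
`campbell_lintegral_collisionCount_shell_le`, `campbell_lintegral_collisionCount_le_liouville`).
The passage from `Alexander.collisionCount` to the collision times of the orbit of a hard-sphere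
flow structure is `HardSphereFlow.ncard_collisionTimes_Ioc_le_collisionCount`.

## Mathlib / Literature reuse

`HardSphereCollisionIntensity` (the model, non-sharp constant), `HardSphereWindowCollisionCount`,
`HardSphereAlexander`, `HardSphereScattering` (`measurableSet_hitPiece`, `measurableSet_energyShell`),
`HardSphereTorusMeasure` (`configEnergy_fwdFlow`). Mathlib: `measure_iUnion_fintype_le`,
`lintegral_iSup`, `ge_of_tendsto`, `lintegral_finsetSum`.

## References

* I. Gallagher, L. Saint-Raymond, B. Texier, *From Newton to Boltzmann: hard spheres and
  short-range potentials*, EMS (2013), arXiv:1208.5753, §4.1, proof of Prop. 4.1.1 (p. 19).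
* C. Cercignani, R. Illner, M. Pulvirenti, *The Mathematical Theory of Dilute Gases*, Springer
  (1994), §4.2, App. 4.A pp. 107–111.
-/

open Set Filter Topology Function MeasureTheory Metric
open scoped ENNReal NNReal

namespace Literature.MathematicalPhysics.KineticTheory

open Literature.Analysis.FluidPDE

noncomputable section

variable {d : Type*} [Fintype d] {N : ℕ} {ε : ℝ}

/-! ## The bookkeeping with a one-window volume bound -/

section Shell

open Literature.Analysis.FluidPDE.Alexander

variable {V : ℝ}

/-- **The truncated count at mesh `t/(m+1)`, sharp form**: for `K : ℕ`, `0 < t` and `m` with the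
chart condition, if the hit pieces of window `δ = t/(m+1)` on the energy shell have total volume
`≤ δ · F`, then `∫⁻_{shell} min(#coll[0,t], K) ≤ K (m+1) · windowLoss + t · F`.
[cite: GST2013, proof of Prop. 4.1.1 p. 19] -/
theorem campbell_lintegral_min_collisionCount_shell_le_of_mesh (hε : 0 < ε) (hV0 : 0 ≤ V)
    {t : ℝ} (ht : 0 < t) (F : ℝ≥0∞)
    (hvol : ∀ δ : ℝ, 0 < δ → ε + 2 * (2 * V * δ) < 2⁻¹ →
      ∑ p : Fin N × Fin N, (if p.1 < p.2 then
        volume (hitPiece N ε (2 * V * δ) δ p.1 p.2 ∩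
          {u : Config N d (UnitAddTorus d) | configEnergy u ≤ V ^ 2 / 2}) else 0) ≤
        ENNReal.ofReal δ * F)
    (K m : ℕ) (hch : ε + 2 * (2 * V * (t / ((m : ℝ) + 1))) < 2⁻¹) :
    ∫⁻ z in {z | z ∈ hardSphereDomain (Torus.geometry d) N ε ∧ configEnergy z ≤ V ^ 2 / 2},
        min (collisionCount (Torus.geometry d) ε z t : ℝ≥0∞) K ∂volume ≤
      (K : ℝ≥0∞) * (((m : ℝ≥0∞) + 1) * windowLoss (d := d) N (t / ((m : ℝ) + 1)) V) +
        ENNReal.ofReal t * F := by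
  -- notation
  set δ : ℝ := t / ((m : ℝ) + 1) with hδ_def
  have hm : (0 : ℝ) < (m : ℝ) + 1 := by positivity
  have hδpos : 0 < δ := div_pos ht hm
  have hδ : 0 ≤ δ := hδpos.le
  have hT : ((m : ℝ) + 1) * δ = t := by rw [hδ_def]; field_simp
  have hε' : ε < 2⁻¹ := by
    have : 0 ≤ 2 * (2 * V * δ) := by positivity
    linarith
  have hG := Torus.isHardSphereRegular_geometry (d := d) hε'
  have hGm : (Torus.geometry d).IsMeasurable := Torus.isMeasurable_geometry
  set S : Set (Config N d (UnitAddTorus d)) :=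
    {z | z ∈ hardSphereDomain (Torus.geometry d) N ε ∧ configEnergy z ≤ V ^ 2 / 2} with hS_def
  have hSm : MeasurableSet S :=
    (measurableSet_hardSphereDomain _ Torus.measurable_geometry_sepVec N ε).inter
      (measurableSet_energyShell _)
  set H : Set (Config N d (UnitAddTorus d)) :=
    ⋃ (p : Fin N × Fin N) (_ : p.1 < p.2), hitPiece N ε (2 * V * δ) δ p.1 p.2 with hH_def
  have hHm : MeasurableSet H :=
    MeasurableSet.iUnion fun p => MeasurableSet.iUnion fun _ => measurableSet_hitPiece ε _ δ p.1 p.2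
  have hHsub : ∀ p : Fin N × Fin N, p.1 < p.2 → hitPiece N ε (2 * V * δ) δ p.1 p.2 ⊆ H :=
    fun p hp z hz => mem_iUnion₂.2 ⟨p, hp, hz⟩
  set B : Set (Config N d (UnitAddTorus d)) :=
    H ∩ {u : Config N d (UnitAddTorus d) | configEnergy u ≤ V ^ 2 / 2} with hB_def
  have hBm : MeasurableSet B := hHm.inter (measurableSet_energyShell _)
  set I : Set (Config N d (UnitAddTorus d)) := iterGood N ε δ V m with hI_def
  have hIm : MeasurableSet I := measurableSet_iterGood hε' δ V m
  set A : ℕ → Set (Config N d (UnitAddTorus d)) := fun w =>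
    {z | z ∈ I ∧ fwdFlow (Torus.geometry d) ε z ((w : ℝ) * δ) ∈ B} with hA_def
  have hAm : ∀ w, MeasurableSet (A w) := fun w =>
    hIm.inter (measurable_fwdFlow hG hGm _ hBm)
  -- pointwise bound on the shell
  have hpt : ∀ z ∈ S, min (collisionCount (Torus.geometry d) ε z t : ℝ≥0∞) K ≤
      (K : ℝ≥0∞) * (S \ I).indicator (fun _ => (1 : ℝ≥0∞)) z +
        ∑ w ∈ Finset.range (m + 1), (A w).indicator (fun _ => (1 : ℝ≥0∞)) z := by
    intro z hzS
    by_cases hzI : z ∈ I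
    · have hcount := collisionCount_le_sum_indicator_of_mem_iterGood hε hch hV0 hδ hHsub m hzI
      rw [hT] at hcount
      refine (min_le_left _ _).trans (hcount.trans ?_)
      refine le_add_left (Finset.sum_le_sum fun w _ => ?_)
      by_cases hw : fwdFlow (Torus.geometry d) ε z ((w : ℝ) * δ) ∈ H
      · have hsh : fwdFlow (Torus.geometry d) ε z ((w : ℝ) * δ) ∈
            {u : Config N d (UnitAddTorus d) | configEnergy u ≤ V ^ 2 / 2} := by
          rw [mem_setOf_eq, configEnergy_fwdFlow]
          exact hzI.1
        rw [indicator_of_mem hw, indicator_of_mem (show z ∈ A w from ⟨hzI, hw, hsh⟩)]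
      · rw [indicator_of_notMem hw]
        exact bot_le
    · refine (min_le_right _ _).trans ?_
      rw [indicator_of_mem (show z ∈ S \ I from ⟨hzS, hzI⟩), mul_one]
      exact le_self_add
  -- integrate
  have hint : ∫⁻ z in S, min (collisionCount (Torus.geometry d) ε z t : ℝ≥0∞) K ∂volume ≤
      (K : ℝ≥0∞) * volume (S \ I) + ∑ w ∈ Finset.range (m + 1), volume (A w) := by
    calc ∫⁻ z in S, min (collisionCount (Torus.geometry d) ε z t : ℝ≥0∞) K ∂volume
        ≤ ∫⁻ z in S, ((K : ℝ≥0∞) * (S \ I).indicator (fun _ => (1 : ℝ≥0∞)) z +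
            ∑ w ∈ Finset.range (m + 1), (A w).indicator (fun _ => (1 : ℝ≥0∞)) z) ∂volume :=
          setLIntegral_mono' hSm fun z hz => hpt z hz
      _ ≤ ∫⁻ z, ((K : ℝ≥0∞) * (S \ I).indicator (fun _ => (1 : ℝ≥0∞)) z +
            ∑ w ∈ Finset.range (m + 1), (A w).indicator (fun _ => (1 : ℝ≥0∞)) z) ∂volume :=
          lintegral_mono' Measure.restrict_le_self le_rfl
      _ = (K : ℝ≥0∞) * volume (S \ I) + ∑ w ∈ Finset.range (m + 1), volume (A w) := by
          rw [lintegral_add_left (((measurable_const.indicator (hSm.diff hIm))).const_mul _),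
            lintegral_const_mul _ (measurable_const.indicator (hSm.diff hIm)),
            lintegral_finsetSum _ fun w _ => measurable_const.indicator (hAm w)]
          congr 1
          · rw [show (fun z => (S \ I).indicator (fun _ => (1 : ℝ≥0∞)) z) = (S \ I).indicator 1 from rfl,
              lintegral_indicator_one (hSm.diff hIm)]
          · refine Finset.sum_congr rfl fun w _ => ?_
            rw [show (fun z => (A w).indicator (fun _ => (1 : ℝ≥0∞)) z) = (A w).indicator 1 from rfl,
              lintegral_indicator_one (hAm w)]
  -- the two volumes
  have hloss : volume (S \ I) ≤ ((m : ℝ≥0∞) + 1) * windowLoss (d := d) N δ V :=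
    volume_shell_diff_iterGood_le hε hch hV0 hδ m
  have hB : volume B ≤ ENNReal.ofReal δ * F := by
    refine le_trans ?_ (hvol δ hδpos hch)
    rw [hB_def, hH_def, iUnion_inter]
    refine (measure_iUnion_fintype_le _ _).trans (Finset.sum_le_sum fun p _ => ?_)
    split_ifs with hp
    · exact measure_mono (inter_subset_inter_left _ (iUnion_subset fun _ => Subset.rfl))
    · rw [iUnion_eq_empty.2 fun h' => (hp h').elim, empty_inter, measure_empty]
  have hAw : ∀ w ∈ Finset.range (m + 1), volume (A w) ≤ volume B := fun w hw =>
    volume_iterGood_inter_preimage_windowStart_le hε hch hV0 hδ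
      (Nat.lt_succ_iff.1 (Finset.mem_range.1 hw)) hBm
  have hsum : ∑ w ∈ Finset.range (m + 1), volume (A w) ≤ ENNReal.ofReal t * F := by
    calc ∑ w ∈ Finset.range (m + 1), volume (A w)
        ≤ ∑ _w ∈ Finset.range (m + 1), volume B := Finset.sum_le_sum hAw
      _ = ((m : ℝ≥0∞) + 1) * volume B := by
          rw [Finset.sum_const, Finset.card_range, nsmul_eq_mul]; push_cast; ring
      _ ≤ ((m : ℝ≥0∞) + 1) * (ENNReal.ofReal δ * F) := by gcongr
      _ = ENNReal.ofReal t * F := by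
          have h1 : ((m : ℝ≥0∞) + 1) = ENNReal.ofReal ((m : ℝ) + 1) := by
            rw [ENNReal.ofReal_add (by positivity) zero_le_one, ENNReal.ofReal_natCast,
              ENNReal.ofReal_one]
          have h3 : ENNReal.ofReal ((m : ℝ) + 1) * ENNReal.ofReal δ = ENNReal.ofReal t := by
            rw [← ENNReal.ofReal_mul hm.le, hT]
          rw [h1, ← mul_assoc, h3]
  calc ∫⁻ z in S, min (collisionCount (Torus.geometry d) ε z t : ℝ≥0∞) K ∂volume
      ≤ (K : ℝ≥0∞) * volume (S \ I) + ∑ w ∈ Finset.range (m + 1), volume (A w) := hint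
    _ ≤ _ := add_le_add (by gcongr) hsum

/-- **The truncated count, sharp form**: `∫⁻_{shell} min(#coll[0,t], K) ≤ t · F` for every `K`
(let the mesh go to zero: `tendsto_windowLoss`). [cite: GST2013, proof of Prop. 4.1.1 p. 19] -/
theorem campbell_lintegral_min_collisionCount_shell_le (hε : 0 < ε) (hε' : ε < 2⁻¹)
    (hV0 : 0 ≤ V) {t : ℝ} (ht : 0 < t) (F : ℝ≥0∞)
    (hvol : ∀ δ : ℝ, 0 < δ → ε + 2 * (2 * V * δ) < 2⁻¹ →
      ∑ p : Fin N × Fin N, (if p.1 < p.2 then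
        volume (hitPiece N ε (2 * V * δ) δ p.1 p.2 ∩
          {u : Config N d (UnitAddTorus d) | configEnergy u ≤ V ^ 2 / 2}) else 0) ≤
        ENNReal.ofReal δ * F)
    (K : ℕ) :
    ∫⁻ z in {z | z ∈ hardSphereDomain (Torus.geometry d) N ε ∧ configEnergy z ≤ V ^ 2 / 2},
        min (collisionCount (Torus.geometry d) ε z t : ℝ≥0∞) K ∂volume ≤ ENNReal.ofReal t * F := by
  have hlim : Tendsto (fun m : ℕ => (K : ℝ≥0∞) * (((m : ℝ≥0∞) + 1) *
      windowLoss (d := d) N (t / ((m : ℝ) + 1)) V) + ENNReal.ofReal t * F) atTop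
      (𝓝 ((K : ℝ≥0∞) * 0 + ENNReal.ofReal t * F)) :=
    (ENNReal.Tendsto.const_mul (tendsto_windowLoss (d := d) (N := N) hV0 ht.le)
      (Or.inr (ENNReal.natCast_ne_top K))).add tendsto_const_nhds
  rw [mul_zero, zero_add] at hlim
  refine ge_of_tendsto hlim ?_
  filter_upwards [eventually_chart hε' V t] with m hm
  exact campbell_lintegral_min_collisionCount_shell_le_of_mesh hε hV0 ht F hvol K m hm

/-- **Sharp collision intensity on energy shells**: for `0 < ε < 1/2`, `V ≥ 0`, `0 < t`, if the
hit pieces of every small window `δ` on the shell `E ≤ V²/2` have total volume `≤ δ · F`, then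
`∫⁻_{z ∈ D_ε^N, E(z) ≤ V²/2} #coll(z, [0, t]) dz ≤ t · F` (monotone convergence in the
truncation level). [cite: GST2013, proof of Prop. 4.1.1 p. 19] -/
theorem campbell_lintegral_collisionCount_shell_le (hε : 0 < ε) (hε' : ε < 2⁻¹) (hV0 : 0 ≤ V)
    {t : ℝ} (ht : 0 < t) (F : ℝ≥0∞)
    (hvol : ∀ δ : ℝ, 0 < δ → ε + 2 * (2 * V * δ) < 2⁻¹ →
      ∑ p : Fin N × Fin N, (if p.1 < p.2 then
        volume (hitPiece N ε (2 * V * δ) δ p.1 p.2 ∩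
          {u : Config N d (UnitAddTorus d) | configEnergy u ≤ V ^ 2 / 2}) else 0) ≤
        ENNReal.ofReal δ * F) :
    ∫⁻ z in {z | z ∈ hardSphereDomain (Torus.geometry d) N ε ∧ configEnergy z ≤ V ^ 2 / 2},
        (collisionCount (Torus.geometry d) ε z t : ℝ≥0∞) ∂volume ≤ ENNReal.ofReal t * F := by
  have hG := Torus.isHardSphereRegular_geometry (d := d) hε'
  have hGm : (Torus.geometry d).IsMeasurable := Torus.isMeasurable_geometry
  have hmeas : Measurable fun z : Config N d (UnitAddTorus d) =>
      (collisionCount (Torus.geometry d) ε z t : ℝ≥0∞) :=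
    (measurable_from_nat (f := fun n : ℕ => (n : ℝ≥0∞))).comp (measurable_collisionCount hG hGm t)
  have hf : ∀ K : ℕ, Measurable fun z : Config N d (UnitAddTorus d) =>
      min (collisionCount (Torus.geometry d) ε z t : ℝ≥0∞) K := fun K => hmeas.min measurable_const
  have hmono : Monotone fun (K : ℕ) (z : Config N d (UnitAddTorus d)) =>
      min (collisionCount (Torus.geometry d) ε z t : ℝ≥0∞) K :=
    fun K K' hKK' z => min_le_min_left _ (by exact_mod_cast hKK')
  have hsup : ∀ z : Config N d (UnitAddTorus d), (collisionCount (Torus.geometry d) ε z t : ℝ≥0∞) =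
      ⨆ K : ℕ, min (collisionCount (Torus.geometry d) ε z t : ℝ≥0∞) K := fun z =>
    le_antisymm (le_iSup_of_le (collisionCount (Torus.geometry d) ε z t) (by simp))
      (iSup_le fun K => min_le_left _ _)
  calc ∫⁻ z in {z | z ∈ hardSphereDomain (Torus.geometry d) N ε ∧ configEnergy z ≤ V ^ 2 / 2},
        (collisionCount (Torus.geometry d) ε z t : ℝ≥0∞) ∂volume
      = ∫⁻ z in {z | z ∈ hardSphereDomain (Torus.geometry d) N ε ∧ configEnergy z ≤ V ^ 2 / 2},
          ⨆ K : ℕ, min (collisionCount (Torus.geometry d) ε z t : ℝ≥0∞) K ∂volume :=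
        lintegral_congr fun z => hsup z
    _ = ⨆ K : ℕ, ∫⁻ z in {z | z ∈ hardSphereDomain (Torus.geometry d) N ε ∧ configEnergy z ≤ V ^ 2 / 2},
          min (collisionCount (Torus.geometry d) ε z t : ℝ≥0∞) K ∂volume := lintegral_iSup hf hmono
    _ ≤ _ := iSup_le fun K => campbell_lintegral_min_collisionCount_shell_le hε hε' hV0 ht F hvol K

/-- **Sharp collision intensity, Liouville form**: the same bound for the Liouville measure
`dZ|_{D_ε^N}` restricted to the energy shell `E ≤ V²/2`. [cite: GST2013, proof of Prop. 4.1.1 p. 19] -/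
theorem campbell_lintegral_collisionCount_le_liouville (hε : 0 < ε) (hε' : ε < 2⁻¹) (hV0 : 0 ≤ V)
    {t : ℝ} (ht : 0 < t) (F : ℝ≥0∞)
    (hvol : ∀ δ : ℝ, 0 < δ → ε + 2 * (2 * V * δ) < 2⁻¹ →
      ∑ p : Fin N × Fin N, (if p.1 < p.2 then
        volume (hitPiece N ε (2 * V * δ) δ p.1 p.2 ∩
          {u : Config N d (UnitAddTorus d) | configEnergy u ≤ V ^ 2 / 2}) else 0) ≤
        ENNReal.ofReal δ * F) :
    ∫⁻ z in {z | configEnergy z ≤ V ^ 2 / 2},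
        (collisionCount (Torus.geometry d) ε z t : ℝ≥0∞) ∂(liouville (Torus.geometry d) N ε) ≤
      ENNReal.ofReal t * F := by
  have hset : {z : Config N d (UnitAddTorus d) | configEnergy z ≤ V ^ 2 / 2} ∩
      hardSphereDomain (Torus.geometry d) N ε =
      {z | z ∈ hardSphereDomain (Torus.geometry d) N ε ∧ configEnergy z ≤ V ^ 2 / 2} := by
    ext z; simp only [mem_inter_iff, mem_setOf_eq]; tauto
  rw [liouville_eq, Measure.restrict_restrict (measurableSet_energyShell _), hset]
  exact campbell_lintegral_collisionCount_shell_le hε hε' hV0 ht F hvol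

end Shell

/-! ## The bound for a hard-sphere flow structure on the torus -/

/-- **Sharp collision intensity for a hard-sphere flow on the torus** (CIP 1994 §4.2 / App. 4.A,
upper bound of the mean number of crossings of the collision boundary; GST 2013, proof of
Prop. 4.1.1): for any hard-sphere flow structure `Φ` on `(T^d × ℝ^d)^N` with `0 < ε < 1/2`, if for
every small window `δ > 0` the hit pieces `hitPiece N ε (2Vδ) δ i j`, `i < j`, of the energy shell
`E ≤ V²/2` have total volume at most `δ · F`, then the number of collision times of the orbit in
`(0, t]` has `∫⁻_{E ≤ V²/2} #(collisionTimes ∩ (0, t]) d(liouville) ≤ t · F`.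
[cite: GST2013, proof of Prop. 4.1.1 p. 19] -/
theorem lintegral_ncard_collisionTimes_le_of_hitPiece_volume (hε : 0 < ε) (hε' : ε < 2⁻¹)
    (Φ : HardSphereFlow (Torus.geometry d) ε N) {V : ℝ} (hV : 0 ≤ V) {t : ℝ} (ht : 0 ≤ t) (F : ℝ≥0∞)
    (hvol : ∀ δ : ℝ, 0 < δ → ε + 2 * (2 * V * δ) < 2⁻¹ →
      ∑ p : Fin N × Fin N, (if p.1 < p.2 then
        volume (Alexander.hitPiece N ε (2 * V * δ) δ p.1 p.2 ∩
          {u : Config N d (UnitAddTorus d) | configEnergy u ≤ V ^ 2 / 2}) else 0) ≤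
        ENNReal.ofReal δ * F) :
    ∫⁻ z in {z | configEnergy z ≤ V ^ 2 / 2},
        ((collisionTimes (Torus.geometry d) ε (fun s => Φ.flow s z) ∩ Ioc 0 t).ncard : ℝ≥0∞)
          ∂(liouville (Torus.geometry d) N ε) ≤ ENNReal.ofReal t * F := by
  rcases ht.eq_or_lt with rfl | ht0
  · simp only [Ioc_self, inter_empty, ncard_empty, Nat.cast_zero, lintegral_zero]
    exact bot_le
  · refine le_trans (lintegral_mono_ae ?_)
      (campbell_lintegral_collisionCount_le_liouville hε hε' hV ht0 F hvol)
    filter_upwards [ae_restrict_of_ae Φ.ae_mem_good] with z hz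
    exact_mod_cast HardSphereFlow.ncard_collisionTimes_Ioc_le_collisionCount hε' Φ hz t

end

end Literature.MathematicalPhysics.KineticTheory
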